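import Summits.HubbardSuperconductivity.HubbardSuperconductivity.Theses.JosephsonMirror
import Literature.Barriers.HubbardSuperconductivity.PureModelStripeCompetition

/-!
# Evidence (line `Sketch`, crux `JmPairBridge`, stmt-HubbardSuperconductivity-2226): the residue stub is the summit

The one remaining stub of line `Sketch`, `stub_orderAndFloorsWitness` (registered skeleton 91f288c1), reads
`∃ U > 0, δ ∈ (0,1/2), HasDWavePairFieldLROAt U δ ∧ GapFloor U δ ∧ ConvexityFloor U δ`. Its FIRST conjunct at
`U > 0`, `δ ∈ (0, 1/2)` is word for word the summit: `HubbardSuperconductivity` unfolds DEFINITIONALLY to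
`∃ U > 0, ∃ δ ∈ Ioo 0 (1/2), HasDWavePairFieldLROAt U δ` (`summit_iff_exists_hasDWavePairFieldLROAt`, by `Iff.rfl`).
Hence the residue implies the summit outright (`sketchResidue_gives_summit`), WITHOUT passing through the crux
`JmPairBridge` or the route's deciding theorem: as a vehicle towards the summit the line is circular — whoever can
discharge the residue has already proved `HubbardSuperconductivity` (and more: two spectral floors).
This file is evidence for `Lines/Sketch.dead.md`; it is not proposed to the tree.
-/

noncomputable section

set_option linter.dupNamespace false

namespace Summit.HubbardSuperconductivity.HubbardSuperconductivity.Theorems.JosephsonMirror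

open Matrix Literature.MathematicalPhysics.QuantumLattice Literature.Barriers.HubbardSuperconductivity
open scoped ComplexOrder

/-- The summit is, definitionally, the summit matrix at some admissible point. [folklore] -/
theorem summit_iff_exists_hasDWavePairFieldLROAt :
    _root_.HubbardSuperconductivity ↔
      ∃ U : ℝ, 0 < U ∧ ∃ δ ∈ Set.Ioo (0 : ℝ) (1 / 2), HasDWavePairFieldLROAt U δ :=
  Iff.rfl

/-- **The residue of line `Sketch` implies the summit outright** (first conjunct; the two spectral floors are
not even used). The hypothesis is VERBATIM the registered stub `stub_orderAndFloorsWitness`. [folklore] -/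
theorem sketchResidue_gives_summit
    (h : ∃ U : ℝ, 0 < U ∧ ∃ δ ∈ Set.Ioo (0 : ℝ) (1 / 2),
      HasDWavePairFieldLROAt U δ ∧
      (∀ C : ℝ, ∃ L₀ : ℕ, ∀ (L : ℕ), Even L → L₀ ≤ L →
        ∀ v : Fock (Orb (FermionTorus 2 L)),
          v ∈ szSector (Λ := FermionTorus 2 L) (2 * ⌊(1 - δ) * (L : ℝ) ^ 2 / 2⌋₊ - 2) 0 →
            (∀ χ : Fock (Orb (FermionTorus 2 L)),
                IsGroundStateInSector (hubbardTorus 2 L 1 U) (2 * ⌊(1 - δ) * (L : ℝ) ^ 2 / 2⌋₊ - 2) 0 χ →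
                  star χ ⬝ᵥ v = 0) →
              ((hubbardTorus 2 L 1 U).minEnergyOn
                    (szSector (Λ := FermionTorus 2 L) (2 * ⌊(1 - δ) * (L : ℝ) ^ 2 / 2⌋₊ - 2) 0) +
                  C / (L : ℝ) ^ 2) * (star v ⬝ᵥ v).re ≤
                (star v ⬝ᵥ hubbardTorus 2 L 1 U *ᵥ v).re) ∧
      (∃ C : ℝ, ∃ L₀ : ℕ, ∀ (L : ℕ), Even L → L₀ ≤ L →
        -C / (L : ℝ) ^ 2 ≤
          (hubbardTorus 2 L 1 U).minEnergyOn
              (szSector (Λ := FermionTorus 2 L) (2 * ⌊(1 - δ) * (L : ℝ) ^ 2 / 2⌋₊ + 2) 0) +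
            (hubbardTorus 2 L 1 U).minEnergyOn
              (szSector (Λ := FermionTorus 2 L) (2 * ⌊(1 - δ) * (L : ℝ) ^ 2 / 2⌋₊ - 2) 0) -
            2 * (hubbardTorus 2 L 1 U).minEnergyOn
              (szSector (Λ := FermionTorus 2 L) (2 * ⌊(1 - δ) * (L : ℝ) ^ 2 / 2⌋₊) 0))) :
    _root_.HubbardSuperconductivity := by
  obtain ⟨U, hU, δ, hδ, hLRO, -, -⟩ := h
  exact ⟨U, hU, δ, hδ, hLRO⟩

/-- Conversely the summit supplies the residue's first conjunct at SOME point — so, modulo the two spectral floors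
holding at every LRO point, the residue is EQUIVALENT to the summit; in particular promoting the residue to an item
would file a statement at least as strong as `HubbardSuperconductivity` itself. [folklore] -/
theorem summit_gives_sketchResidue_firstConjunct (h : _root_.HubbardSuperconductivity) :
    ∃ U : ℝ, 0 < U ∧ ∃ δ ∈ Set.Ioo (0 : ℝ) (1 / 2), HasDWavePairFieldLROAt U δ :=
  h

end Summit.HubbardSuperconductivity.HubbardSuperconductivity.Theorems.JosephsonMirror

end
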